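import Summits.ResolutionOfSingularities.KangarooAtlas.MizutaniAttainedPoint
import Summits.ResolutionOfSingularities.KangarooAtlas.MizutaniTowerIdeals
import Mathlib.Algebra.Ring.GeomSum
import HarnessLib

/-!
# Mizutani's conjecture `m(e) = 2p^e − 1` — the invariant forms of the point realising `H_e` are one-dimensional

Cell topic `Summits/ResolutionOfSingularities/KangarooAtlas` (pub-rosobs); namespace
`Summit.ResolutionOfSingularities.KangarooAtlas.Mizutani`.  Part of the Lean transcription of the
in-house note MIZUTANI-PROOF-g59 (AI-written, AI-audited; *AI review is weaker than expert review*; not a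
resolution theorem).  ATTAINMENT, step 3, for the point `attP ⊂ k[X_0, …, X_N]` of `MizutaniAttainedPoint`
(`k = F(u_0,u_1)`, `N + 1 = 2q`, `q = p^e`, `e ≥ 1`):

* `coeff_pPlus`, `totalDegree_pPlus_le`, `homogeneousComponent_pPlus` — the polynomials `(u + X)^W`;
* **`attKey`** — if `Σ_i a_i (u + X)^{p^m W_i}` only involves monomials of degree `≥ p^m q`, then `a` is a
  multiple of ONE explicit vector `attV m` (top homogeneous component, then the substitution `X ↦ X − u`);
* **`invForms_attP_le_span`** / `finrank_invForms_attP_le_one` — `(L_B)_{e+m}(attP) ⊆ k · attV m` for every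
  `m ≥ 0`, through `mem_invForms_attP_iff`, `Omega_attBeta` and encloser-2's `degree_le_of_mem_pow`;
* **`attA0_mem_invForms`** — the explicit vector `a⁰` (left coefficients of Mizutani's relation
  `ω = t_0 t_1^{q−1} = Σ_i a⁰_i ⊗ c_i`, note §10) lies in `(L_B)_e`: `Σ_j u_1^{q−1−j} ⊗ u_1^j = (1⊗u_1 − u_1⊗1)^{q−1}`
  (geometric sum read in the tower coordinates, `Ω̃` injective), so `ω ∈ J·J^{q−1} = J^q`;
* `finrank_invForms_attP` — **`dim_k (L_B)_e(attP) = 1`**.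

References: [Mizutani1973HironakaGroupSchemes] Remark 2.10 (H_e), Example 2.1; in-house note §10 (attainment);
[Oda1983HironakaGroupSchemeII] Thm. 3.1.
-/

open MvPolynomial TensorProduct Literature.AlgebraicGeometry.Resolution
  Literature.AlgebraicGeometry.Resolution.HironakaScheme

namespace Summit.ResolutionOfSingularities.KangarooAtlas.Mizutani

universe u

/-! ## The polynomials `(u + X)^W` -/

section PPlus

variable {K : Type*} [Field K] {s : ℕ} (a : Fin s → K)

/-- **Coefficients of `(a + X)^N`**: `coeff_V (a+X)^N = C(N,V) a^{N−V}` (binomial expansion; `C(N,V) = 0` unless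
`V ≤ N`). [cite: EGAIV4, Thm. 16.11.2 (16.11.2.1)] -/
theorem coeff_pPlus (V N : Fin s →₀ ℕ) :
    coeff V (pPlus a N) = (mchoose N V : K) * ∏ i, a i ^ (N i - V i) := by
  classical
  have key : pPlus a N = MvPolynomial.map (eval a) (taylor K (monomial N (1 : K))) := by
    unfold pPlus
    rw [monomial_eq, C_1, one_mul, map_finsuppProd, map_finsuppProd, Finsupp.prod_fintype _ _ (fun i => by simp)]
    refine Finset.prod_congr rfl fun i _ => ?_
    rw [map_pow, map_pow, taylor_X, map_add, map_C, map_X, eval_X]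
  rw [key, coeff_map, ← hasseDeriv_apply, hasseDeriv_monomial, map_mul, map_natCast, monomial_eq, C_1, one_mul,
    map_finsuppProd, Finsupp.prod_fintype _ _ (fun i => by simp)]
  congr 1
  exact Finset.prod_congr rfl fun i _ => by rw [map_pow, eval_X, Finsupp.tsub_apply]

/-- A monomial of `(a + X)^N` has exponent `≤ N`. [folklore] -/
theorem le_of_mem_support_pPlus {V N : Fin s →₀ ℕ} (hV : V ∈ (pPlus a N).support) : V ≤ N := by
  by_contra h
  rw [mem_support_iff, coeff_pPlus, mchoose_eq_zero_of_not_le h, Nat.cast_zero, zero_mul] at hV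
  exact hV rfl

/-- `totalDegree (a + X)^N ≤ |N|`. [folklore] -/
theorem totalDegree_pPlus_le (N : Fin s →₀ ℕ) : (pPlus a N).totalDegree ≤ N.degree := by
  rw [totalDegree]
  refine Finset.sup_le fun V hV => ?_
  have hle := le_of_mem_support_pPlus a hV
  rw [Finsupp.degree_eq_sum]
  show (V.sum fun _ e => e) ≤ _
  rw [Finsupp.sum_fintype _ _ (fun _ => rfl)]
  exact Finset.sum_le_sum fun i _ => hle i

omit [Field K] in
/-- `V ≤ N` with `|V| = |N|` forces `V = N`. [folklore] -/
theorem eq_of_le_of_degree_eq {V N : Fin s →₀ ℕ} (hle : V ≤ N) (hdeg : V.degree = N.degree) : V = N := by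
  rw [Finsupp.degree_eq_sum, Finsupp.degree_eq_sum] at hdeg
  ext i
  have hi : V i ≤ N i := hle i
  by_contra hne
  have hlt : V i < N i := lt_of_le_of_ne hi hne
  have : ∑ j, V j < ∑ j, N j :=
    Finset.sum_lt_sum (fun j _ => hle j) ⟨i, Finset.mem_univ i, hlt⟩
  omega

/-- **The top homogeneous component of `(a + X)^N` is `X^N`.** [folklore] -/
theorem homogeneousComponent_pPlus (N : Fin s →₀ ℕ) :
    homogeneousComponent N.degree (pPlus a N) = monomial N 1 := by
  classical
  rw [homogeneousComponent_apply, Finset.sum_eq_single N]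
  · rw [coeff_pPlus, mchoose_self, Nat.cast_one, one_mul]
    congr 1
    exact Finset.prod_eq_one fun i _ => by rw [Nat.sub_self, pow_zero]
  · intro V hV hVN
    exfalso
    rw [Finset.mem_filter] at hV
    exact hVN (eq_of_le_of_degree_eq (le_of_mem_support_pPlus a hV.1) hV.2)
  · intro hN
    exfalso
    apply hN
    rw [Finset.mem_filter, mem_support_iff, coeff_pPlus, mchoose_self, Nat.cast_one, one_mul]
    refine ⟨?_, rfl⟩
    rw [Finset.prod_eq_one fun i _ => by rw [Nat.sub_self, pow_zero]]
    exact one_ne_zero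

/-- The substitution `X_i ↦ X_i − a_i` sends `(a + X)^N` to `X^N`. [folklore] -/
theorem aeval_sub_pPlus (N : Fin s →₀ ℕ) :
    aeval (fun i => (X i - C (a i) : MvPolynomial (Fin s) K)) (pPlus a N) = monomial N 1 := by
  unfold pPlus
  rw [map_prod, monomial_eq, C_1, one_mul, Finsupp.prod_fintype _ _ (fun i => by simp)]
  refine Finset.prod_congr rfl fun i _ => ?_
  rw [map_pow, map_add, aeval_C, aeval_X, algebraMap_eq, add_sub_cancel]

end PPlus

/-! ## The key dimension estimate -/

section Key

variable {F : Type u} [Field F] {p e : ℕ} [hp : Fact p.Prime] [CharP F p]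

/-- The distinguished index `i* = (1, q−1)` (the monomial `c_{i*} = u_0 u_1^{q−1}` of top degree `q`). [folklore] -/
def attTop : Fin (attN p e + 1) :=
  (attIdx p e).symm (1, ⟨p ^ e - 1, Nat.sub_lt (pow_pos hp.out.pos e) Nat.one_pos⟩)

/-- `|W_{i*}| = q`. [folklore] -/
theorem degree_attW_attTop : (attW p e (attTop (p := p) (e := e))).degree = p ^ e := by
  rw [Finsupp.degree_eq_sum, Fin.sum_univ_two, attW_zero, attW_one]
  unfold attTop
  rw [Equiv.apply_symm_apply]
  have : 1 ≤ p ^ e := Nat.one_le_pow _ _ hp.out.pos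
  simp only [Fin.val_one]
  omega

/-- `|W_i| ≤ q − 1` for `i ≠ i*`. [folklore] -/
theorem degree_attW_lt {i : Fin (attN p e + 1)} (hi : i ≠ attTop) : (attW p e i).degree + 1 ≤ p ^ e := by
  rw [Finsupp.degree_eq_sum, Fin.sum_univ_two, attW_zero, attW_one]
  have h1 : ((attIdx p e i).1 : ℕ) < 2 := ((attIdx p e i).1).2
  have h2 : ((attIdx p e i).2 : ℕ) < p ^ e := ((attIdx p e i).2).2
  -- if both coordinates were maximal, `i = i*`
  by_contra hcon
  apply hi
  unfold attTop
  rw [← Equiv.apply_eq_iff_eq_symm_apply]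
  refine Prod.ext (Fin.ext ?_) (Fin.ext ?_)
  · simp only [Fin.val_one]; omega
  · simp only; omega

/-- `|p^m W_i| = p^m |W_i|`. [folklore] -/
theorem degree_nsmul (m : ℕ) (W : Fin 2 →₀ ℕ) : (m • W).degree = m * W.degree := by
  rw [map_nsmul, smul_eq_mul]

/-- The reference polynomial `R_m = (X − u)^{p^m W_{i*}}` and the vector `attV m` of its coefficients at the
exponents `p^m W_i`: the unique (up to scalars) solution of the key estimate. [folklore] -/
noncomputable def attV (F : Type u) [Field F] (p e : ℕ) [Fact p.Prime] [CharP F p] (m : ℕ)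
    (i : Fin (attN p e + 1)) : RatField F 2 :=
  coeff (p ^ m • attW p e i)
    (aeval (fun l => (X l - C (ratGen F 2 l) : MvPolynomial (Fin 2) (RatField F 2)))
      (monomial (p ^ m • attW p e (attTop (p := p) (e := e))) (1 : RatField F 2)))

/-- **KEY ESTIMATE**: if `P = Σ_i a_i (u + X)^{p^m W_i}` only has monomials of degree `≥ p^m q`, then
`a = a_{i*} · attV m`.  (Since `totalDegree P ≤ p^m q`, `P` is its own top component
`= a_{i*} X^{p^m W_{i*}}`; substitute `X ↦ X − u` and compare coefficients.)
[cite: Mizutani1973HironakaGroupSchemes, Remark 2.10 (dim H_e = 2p^e − 1: the invariant forms of H_e are one-dimensional)] -/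
theorem attKey (m : ℕ) (a : Fin (attN p e + 1) → RatField F 2)
    (hdeg : ∀ M ∈ (∑ i, C (a i) * pPlus (ratGen F 2) (p ^ m • attW p e i)).support, p ^ (e + m) ≤ M.degree) :
    a = a attTop • attV F p e m := by
  classical
  set u := ratGen F 2 with hu
  set d := p ^ (e + m) with hd
  set P := ∑ i, C (a i) * pPlus u (p ^ m • attW p e i) with hP
  have hpm : 0 < p ^ m := pow_pos hp.out.pos m
  -- degrees of the summands
  have hdegTop : (p ^ m • attW p e (attTop (p := p) (e := e))).degree = d := by
    rw [degree_nsmul, degree_attW_attTop, hd, pow_add, mul_comm]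
  have hdegLt : ∀ i, i ≠ attTop → (p ^ m • attW p e i).degree < d := by
    intro i hi
    rw [degree_nsmul, hd, pow_add, mul_comm (p ^ e)]
    have := degree_attW_lt hi
    exact (Nat.mul_lt_mul_left hpm).mpr (by omega)
  have htd : P.totalDegree ≤ d := by
    refine (totalDegree_finsetSum _ _).trans (Finset.sup_le fun i _ => ?_)
    refine (totalDegree_mul _ _).trans ?_
    rw [totalDegree_C, zero_add]
    refine (totalDegree_pPlus_le u _).trans ?_
    by_cases hi : i = attTop
    · rw [hi, hdegTop]
    · exact (hdegLt i hi).le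
  -- (1) `P` is its own degree-`d` component
  have hP1 : P = homogeneousComponent d P := by
    refine MvPolynomial.ext _ _ fun M => ?_
    rw [coeff_homogeneousComponent]
    split_ifs with hM
    · rfl
    · by_contra hne
      have hmem : M ∈ P.support := mem_support_iff.mpr (Ne.symm hne ∘ Eq.symm)
      have h1 := hdeg M hmem
      have h2 : M.degree ≤ P.totalDegree := by
        have := le_totalDegree hmem
        rwa [Finsupp.degree_eq_sum, ← Finsupp.sum_fintype M (fun _ e => e) (fun _ => rfl)]
      exact hM (le_antisymm (h2.trans htd) h1)
  -- (2) the degree-`d` component is `a_{i*} X^{p^m W_{i*}}`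
  have hP2 : homogeneousComponent d P = C (a attTop) * monomial (p ^ m • attW p e attTop) 1 := by
    rw [hP, map_sum, Finset.sum_eq_single attTop]
    · rw [homogeneousComponent_C_mul, ← hdegTop, homogeneousComponent_pPlus]
    · intro i _ hi
      rw [homogeneousComponent_C_mul, homogeneousComponent_eq_zero, mul_zero]
      exact lt_of_le_of_lt (totalDegree_pPlus_le u _) (hdegLt i hi)
    · intro h; exact absurd (Finset.mem_univ _) h
  -- (3) substitute `X ↦ X − u` and compare coefficients at `p^m W_i`
  set σ := aeval (R := RatField F 2) (fun l => (X l - C (u l) : MvPolynomial (Fin 2) (RatField F 2))) with hσ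
  have hσP : σ P = ∑ i, monomial (p ^ m • attW p e i) (a i) := by
    rw [hP, map_sum]
    refine Finset.sum_congr rfl fun i _ => ?_
    rw [map_mul, aeval_C, algebraMap_eq, aeval_sub_pPlus, C_mul_monomial, mul_one]
  have hσP' : σ P = C (a attTop) *
      σ (monomial (p ^ m • attW p e (attTop (p := p) (e := e))) (1 : RatField F 2)) := by
    conv_lhs => rw [hP1, hP2]
    rw [map_mul, aeval_C, algebraMap_eq]
  funext i
  have hcoef := congrArg (coeff (p ^ m • attW p e i)) (hσP.symm.trans hσP')
  rw [coeff_sum, Finset.sum_eq_single i, coeff_monomial, if_pos rfl, coeff_C_mul] at hcoef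
  · rw [hcoef, Pi.smul_apply, smul_eq_mul]
    rfl
  · intro j _ hji
    rw [coeff_monomial, if_neg]
    intro h
    exact hji (attW_injective p e (smul_right_injective _ hpm.ne' h))
  · intro h; exact absurd (Finset.mem_univ i) h

/-- **`(L_B)_{e+m}(attP) ⊆ k · attV m`** for every `m ≥ 0`. [cite: Mizutani1973HironakaGroupSchemes, Remark 2.10 (e(H_e) = e, dim H_e = 2p^e − 1)] -/
theorem invForms_attP_le_span (hF : ∀ c : F, c ^ p = c) (he : 1 ≤ e) (m : ℕ) :
    invForms (RatField F 2) p (attP F p e) (e + m) ≤ Submodule.span (RatField F 2) {attV F p e m} := by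
  intro a ha
  rw [mem_invForms_attP_iff] at ha
  have hdeg := (isRootTower_ratField (s := 2) hF (e := e + m) (by omega)).degree_le_of_mem_pow ha
  rw [Omega_attBeta hF he m a] at hdeg
  rw [attKey m a hdeg]
  exact Submodule.smul_mem _ _ (Submodule.mem_span_singleton_self _)

/-- Hence `dim_k (L_B)_{e+m}(attP) ≤ 1`. [cite: Mizutani1973HironakaGroupSchemes, Remark 2.10] -/
theorem finrank_invForms_attP_le_one (hF : ∀ c : F, c ^ p = c) (he : 1 ≤ e) (m : ℕ) :
    Module.finrank (RatField F 2) (invForms (RatField F 2) p (attP F p e) (e + m)) ≤ 1 :=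
  (Submodule.finrank_mono (invForms_attP_le_span hF he m)).trans (finrank_span_le_card ({attV F p e m} : Set _) |>.trans
    (by rw [Set.toFinset_card, Set.card_singleton]))

/-! ## Mizutani's relation `ω = t_0 t_1^{q−1}` and its coefficient vector `a⁰` -/

/-- The left coefficients `a⁰` of `ω = t_0 (1 ⊗ u_1 − u_1 ⊗ 1)^{q−1} = Σ_i a⁰_i ⊗ c_i`:
`a⁰_{(0,j)} = u_0 u_1^{q−1−j}`, `a⁰_{(1,j)} = −u_1^{q−1−j}`. [cite: Mizutani1973HironakaGroupSchemes, Remark 2.10 (in-house proof §10: ω = t_1 t_2^{q−1} has rank 2q)] -/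
noncomputable def attA0 (F : Type u) [Field F] (p e : ℕ) [Fact p.Prime] [CharP F p] (i : Fin (attN p e + 1)) :
    RatField F 2 :=
  if (attIdx p e i).1 = 0 then ratGen F 2 0 * ratGen F 2 1 ^ (p ^ e - 1 - (attIdx p e i).2)
  else -(ratGen F 2 1 ^ (p ^ e - 1 - (attIdx p e i).2))

/-- `a⁰_{i*} = −1`. [folklore] -/
theorem attA0_attTop : attA0 F p e attTop = -1 := by
  unfold attA0 attTop
  rw [Equiv.apply_symm_apply]
  simp

/-- `a⁰ ≠ 0`. [folklore] -/
theorem attA0_ne_zero : attA0 F p e ≠ 0 := by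
  intro h
  have := congrFun h attTop
  rw [attA0_attTop, Pi.zero_apply] at this
  exact one_ne_zero (neg_eq_zero.mp this)

/-- The geometric sum `S = Σ_{j<q} u_1^{q−1−j} ⊗ u_1^j`. [folklore] -/
noncomputable def attS (F : Type u) [Field F] (p e : ℕ) [Fact p.Prime] [CharP F p] :
    RatField F 2 ⊗[frobPow (RatField F 2) p e] RatField F 2 :=
  ∑ j : Fin (p ^ e), (ratGen F 2 1 ^ (p ^ e - 1 - j)) ⊗ₜ[frobPow (RatField F 2) p e] (ratGen F 2 1 ^ (j : ℕ))

/-- `β_0(a⁰) = (u_0 ⊗ 1 − 1 ⊗ u_0) · S`. [cite: Mizutani1973HironakaGroupSchemes, Remark 2.10 (in-house proof §10)] -/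
theorem attBeta_zero_attA0 : attBeta 0 (attA0 F p e) =
    (ratGen F 2 0 ⊗ₜ[frobPow (RatField F 2) p e] 1 - 1 ⊗ₜ[frobPow (RatField F 2) p e] ratGen F 2 0) * attS F p e := by
  show (∑ i, attA0 F p e i ⊗ₜ[frobPow (RatField F 2) p e] (attC F p e i ^ p ^ 0)) = _
  set u := ratGen F 2 with hu
  set L := frobPow (RatField F 2) p e with hL
  unfold attS
  have hC : ∀ i, attC F p e i ^ p ^ 0 = u 0 ^ ((attIdx p e i).1 : ℕ) * u 1 ^ ((attIdx p e i).2 : ℕ) := by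
    intro i
    rw [pow_zero, pow_one]
    unfold attC
    rw [Fin.prod_univ_two, attW_zero, attW_one]
  simp_rw [hC]
  set g : Fin 2 × Fin (p ^ e) → RatField F 2 ⊗[L] RatField F 2 := fun x =>
    (if x.1 = 0 then u 0 * u 1 ^ (p ^ e - 1 - x.2) else -(u 1 ^ (p ^ e - 1 - x.2))) ⊗ₜ[L]
      (u 0 ^ (x.1 : ℕ) * u 1 ^ (x.2 : ℕ)) with hg
  rw [Fintype.sum_equiv (attIdx p e)
      (fun i => attA0 F p e i ⊗ₜ[L] (u 0 ^ ((attIdx p e i).1 : ℕ) * u 1 ^ ((attIdx p e i).2 : ℕ))) g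
      (fun i => by rw [hg]; unfold attA0; rfl), Fintype.sum_prod_type g,
    Fin.sum_univ_two, ← Finset.sum_add_distrib, sub_mul, Finset.mul_sum, Finset.mul_sum, ← Finset.sum_sub_distrib]
  refine Finset.sum_congr rfl fun j _ => ?_
  rw [hg]
  simp only [Fin.isValue, ↓reduceIte, one_ne_zero, Fin.val_zero, pow_zero, one_mul,
    Fin.val_one, pow_one, Algebra.TensorProduct.tmul_mul_tmul, TensorProduct.neg_tmul]
  rw [sub_eq_add_neg]

/-- In `k[X_0, X_1]`: `Σ_{j<q} (u_1 + X_1)^j u_1^{q−1−j} = X_1^{q−1}` (geometric sum; `(u_1 + X_1)^q − u_1^q = X_1^q`).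
[folklore] -/
theorem geomSum_eq_X_pow : (∑ j : Fin (p ^ e), (C (ratGen F 2 1) + X 1) ^ (j : ℕ) * C (ratGen F 2 1) ^ (p ^ e - 1 - j)
      : MvPolynomial (Fin 2) (RatField F 2)) = X 1 ^ (p ^ e - 1) := by
  set x : MvPolynomial (Fin 2) (RatField F 2) := C (ratGen F 2 1) + X 1 with hx
  set y : MvPolynomial (Fin 2) (RatField F 2) := C (ratGen F 2 1) with hy
  have hq : p ^ e = (p ^ e - 1) + 1 := (Nat.sub_add_cancel (Nat.one_le_pow _ _ hp.out.pos)).symm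
  have hgs := geom_sum₂_mul x y (p ^ e)
  rw [Fin.sum_univ_eq_sum_range (fun j => x ^ j * y ^ (p ^ e - 1 - j)) (p ^ e)]
  have hxy : x - y = X 1 := by rw [hx, hy]; ring
  have hxq : x ^ p ^ e - y ^ p ^ e = X 1 ^ p ^ e := by
    rw [hx, hy, add_pow_char_pow, add_sub_cancel_left]
  rw [hxy, hxq] at hgs
  conv_rhs at hgs => rw [hq, pow_succ]
  exact mul_right_cancel₀ (X_ne_zero (1 : Fin 2)) hgs

/-- **`S = (1 ⊗ u_1 − u_1 ⊗ 1)^{q−1}`** (read `S` in the tower coordinates: `Ω̃ S = X_1^{q−1}`, `Ω̃` injective).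
[cite: Mizutani1973HironakaGroupSchemes, Remark 2.10 (in-house proof §1.2: t^{q−1} and the left k-basis t^M)] -/
theorem attS_eq (hF : ∀ c : F, c ^ p = c) (he : 1 ≤ e) : attS F p e =
    ((1 : RatField F 2) ⊗ₜ[frobPow (RatField F 2) p e] ratGen F 2 1 -
      ratGen F 2 1 ⊗ₜ[frobPow (RatField F 2) p e] 1) ^ (p ^ e - 1) := by
  set h := isRootTower_ratField (s := 2) hF (e := e) he with hh
  apply (h.omegaTilde_bijective (finrank_ratField (s := 2) hF he)).1
  have hX : h.omegaTilde ((1 : RatField F 2) ⊗ₜ[frobPow (RatField F 2) p e] ratGen F 2 1 -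
      ratGen F 2 1 ⊗ₜ[frobPow (RatField F 2) p e] 1) = Ideal.Quotient.mk _ (X 1) := by
    rw [map_sub, (h.omegaTilde_one_tmul _).1, (h.omegaTilde_one_tmul _).2, h.tau_gen, ← map_sub, add_sub_cancel_left]
  rw [map_pow, hX, ← map_pow, ← geomSum_eq_X_pow, map_sum]
  unfold attS
  rw [map_sum]
  refine Finset.sum_congr rfl fun j _ => ?_
  rw [h.omegaTilde_tmul, map_pow h.tau, h.tau_gen, ← map_pow, ← map_mul, C_pow, mul_comm]

/-- **`β_0(a⁰) ∈ J^q`**: `ω = t_0 · t_1^{q−1}` is a product of `q` elements of the diagonal ideal.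
[cite: Mizutani1973HironakaGroupSchemes, Remark 2.10 (in-house proof §10: ω = t_1 t_2^{q−1} is genuine)] -/
theorem attBeta_zero_attA0_mem (hF : ∀ c : F, c ^ p = c) (he : 1 ≤ e) :
    attBeta 0 (attA0 F p e) ∈ KaehlerDifferential.ideal (frobPow (RatField F 2) p e) (RatField F 2) ^ p ^ e := by
  have hq : p ^ e = (p ^ e - 1) + 1 := (Nat.sub_add_cancel (Nat.one_le_pow _ _ hp.out.pos)).symm
  have hJ : KaehlerDifferential.ideal (frobPow (RatField F 2) p e) (RatField F 2) ^ p ^ e =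
      KaehlerDifferential.ideal (frobPow (RatField F 2) p e) (RatField F 2) *
        KaehlerDifferential.ideal (frobPow (RatField F 2) p e) (RatField F 2) ^ (p ^ e - 1) := by
    conv_lhs => rw [hq]
    rw [pow_succ']
  rw [attBeta_zero_attA0, attS_eq hF he, hJ]
  refine Ideal.mul_mem_mul ?_ (Ideal.pow_mem_pow (KaehlerDifferential.one_smul_sub_smul_one_mem_ideal _ _) _)
  have := KaehlerDifferential.one_smul_sub_smul_one_mem_ideal (frobPow (RatField F 2) p e) (ratGen F 2 0)
  rw [← neg_sub]
  exact Submodule.neg_mem _ this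

/-- **`a⁰ ∈ (L_B)_e(attP)`**. [cite: Mizutani1973HironakaGroupSchemes, Remark 2.10 (H_e has a nonzero invariant additive form of level e)] -/
theorem attA0_mem_invForms (hF : ∀ c : F, c ^ p = c) (he : 1 ≤ e) :
    attA0 F p e ∈ invForms (RatField F 2) p (attP F p e) e :=
  (mem_invForms_attP_iff 0 (attA0 F p e)).mpr (attBeta_zero_attA0_mem hF he)

/-- **`dim_k (L_B)_e(attP) = 1`.** [cite: Mizutani1973HironakaGroupSchemes, Remark 2.10 (dim H_e = 2p^e − 1)] -/
theorem finrank_invForms_attP (hF : ∀ c : F, c ^ p = c) (he : 1 ≤ e) :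
    Module.finrank (RatField F 2) (invForms (RatField F 2) p (attP F p e) e) = 1 := by
  refine le_antisymm (finrank_invForms_attP_le_one hF he 0) ?_
  have hle : Submodule.span (RatField F 2) {attA0 F p e} ≤ invForms (RatField F 2) p (attP F p e) e := by
    rw [Submodule.span_le, Set.singleton_subset_iff]
    exact attA0_mem_invForms hF he
  have := Submodule.finrank_mono hle
  rwa [finrank_span_singleton attA0_ne_zero] at this

end Key

end Summit.ResolutionOfSingularities.KangarooAtlas.Mizutani
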